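import Summits.Ventures.PercRepro.S1SevenSixTripleFour

/-!
# PercRepro — THE PROFILE OF A COLOOP-FREE SIMPLE RANK-4 MATROID ON 7 POINTS THROUGH ITS SPANNING SETS (p2, gen
28; SUBCLAIM-S1 §6.10 (xvii)(o); towards the shape `(rank 3 on 6) ⊕ (rank 4 on 7)` of `(7, 6)`)

With `t` the rank-`2` triples, `q₂` the rank-`2` four-sets, `s₄`, `s₅` the spanning `4`- and `5`-sets:
`f(2) + f(3) + s₄ + s₅ ≥ 112`, `f(3) + f(4) + t + q₂ ≥ 99`, `f(4) ≥ 8 + s₅ + s₄`, `N(4, 3) + t ≤ 35`,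
`N(4, 2) ≤ s₅ + t`, `t + q₂ ≤ 21`. Nothing is claimed about any cell.

* `eRk_five_six_rank_four_seven`, `eRk_three_four_rank_four_seven` — the ranks by size;
* `ncard_rankSet_two_add_three_add_spanning_ge_rank_four_seven`,
  `ncard_rankSet_three_add_four_add_rankTwo_ge_rank_four_seven`, `ncard_rankSet_four_ge_rank_four_seven`,
  `ncard_profileSet_four_three_le_rank_four_seven`, `ncard_profileSet_four_two_le_rank_four_seven`,
  `ncard_rankTwoTriples_add_rankTwo_four_le_rank_four_seven`.
Axioms: standard.
-/

open scoped Matroid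

namespace PercRepro

namespace S1

open Set

variable {α : Type}

section RankFourOnSeven

variable {N : Matroid α} [N.Finite]

/-- The ranks of the `k`-sets, `k = 3 … 6`, in a coloop-free matroid of rank `4` on `7` points with all pairs
of rank `2`: a `5`-set has rank `3` or `4`, a `6`-set rank `4`. -/
theorem eRk_five_six_rank_four_seven (hN : N.eRank = ((4 : ℕ) : ℕ∞)) (hE : N.E.ncard = 7) (hcol : N.coloops = ∅)
    {X : Set α} (hX : X ⊆ N.E) :
    (X.ncard = 5 → N.eRk X = ((3 : ℕ) : ℕ∞) ∨ N.eRk X = ((4 : ℕ) : ℕ∞)) ∧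
      (X.ncard = 6 → N.eRk X = ((4 : ℕ) : ℕ∞)) := by
  have hhi : N.eRk X ≤ N.eRank := N.eRk_le_eRank X
  rw [hN] at hhi
  obtain ⟨n, hn⟩ := ENat.ne_top_iff_exists.mp (ne_top_of_le_ne_top (by decide) hhi)
  rw [← hn] at hhi ⊢
  have hhi' : n ≤ 4 := by exact_mod_cast hhi
  have hmiss : n < 4 → 4 - n + 1 ≤ (N.E \ X).ncard := fun h =>
    sub_add_one_le_ncard_ground_sdiff_of_coloops N hN hcol hX hn.symm h
  have hc : (N.E \ X).ncard = 7 - X.ncard := by rw [ncard_sdiff' hX N.ground_finite, hE]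
  constructor
  · intro h5
    rw [h5] at hc
    rcases Nat.lt_or_ge n 4 with h | h
    · have := hmiss h
      rw [hc] at this
      have hn3 : n = 3 := by omega
      left; rw [hn3]
    · have hn4 : n = 4 := by omega
      right; rw [hn4]
  · intro h6
    rw [h6] at hc
    rcases Nat.lt_or_ge n 4 with h | h
    · have := hmiss h
      rw [hc] at this
      omega
    · have hn4 : n = 4 := by omega
      rw [hn4]

/-- A `4`-set has rank `2`, `3` or `4`; a `3`-set rank `2` or `3`. -/
theorem eRk_three_four_rank_four_seven (hN : N.eRank = ((4 : ℕ) : ℕ∞))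
    (hpairs : ∀ e ∈ N.E, ∀ f ∈ N.E, e ≠ f → N.eRk {e, f} = 2) {X : Set α} (hX : X ⊆ N.E) :
    (X.ncard = 3 → N.eRk X = ((2 : ℕ) : ℕ∞) ∨ N.eRk X = ((3 : ℕ) : ℕ∞)) ∧
      (X.ncard = 4 → N.eRk X = ((2 : ℕ) : ℕ∞) ∨ N.eRk X = ((3 : ℕ) : ℕ∞) ∨ N.eRk X = ((4 : ℕ) : ℕ∞)) := by
  have hhi : N.eRk X ≤ N.eRank := N.eRk_le_eRank X
  rw [hN] at hhi
  obtain ⟨n, hn⟩ := ENat.ne_top_iff_exists.mp (ne_top_of_le_ne_top (by decide) hhi)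
  rw [← hn] at hhi ⊢
  have hhi' : n ≤ 4 := by exact_mod_cast hhi
  constructor
  · intro h3
    have hlo := two_le_eRk_of_two_le_ncard hpairs hX (by omega)
    have hle : N.eRk X ≤ 3 := by
      have := N.eRk_le_encard X
      rwa [← (N.ground_finite.subset hX).cast_ncard_eq, h3] at this
    rw [← hn] at hlo hle
    have hlo' : 2 ≤ n := by exact_mod_cast hlo
    have hle' : n ≤ 3 := by exact_mod_cast hle
    rcases Nat.lt_or_ge n 3 with h | h
    · left; have : n = 2 := by omega
      rw [this]
    · right; have : n = 3 := by omega
      rw [this]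
  · intro h4
    have hlo := two_le_eRk_of_two_le_ncard hpairs hX (by omega)
    rw [← hn] at hlo
    have hlo' : 2 ≤ n := by exact_mod_cast hlo
    rcases Nat.lt_or_ge n 3 with h | h
    · left; have : n = 2 := by omega
      rw [this]
    rcases Nat.lt_or_ge n 4 with h' | h'
    · right; left; have : n = 3 := by omega
      rw [this]
    · right; right; have : n = 4 := by omega
      rw [this]

/-- `f(2) + f(3) + s₄ + s₅ ≥ 112`: the pairs, the `3`-sets, the non-spanning `4`-sets and the non-spanning
`5`-sets all have rank `2` or `3`. -/
theorem ncard_rankSet_two_add_three_add_spanning_ge_rank_four_seven (hN : N.eRank = ((4 : ℕ) : ℕ∞))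
    (hE : N.E.ncard = 7) (hcol : N.coloops = ∅) (hpairs : ∀ e ∈ N.E, ∀ f ∈ N.E, e ≠ f → N.eRk {e, f} = 2) :
    112 ≤ (rankSet N 2).ncard + (rankSet N 3).ncard +
      {Q : Set α | Q ⊆ N.E ∧ Q.ncard = 4 ∧ N.eRk Q = ((4 : ℕ) : ℕ∞)}.ncard +
      {Q : Set α | Q ⊆ N.E ∧ Q.ncard = 5 ∧ N.eRk Q = ((4 : ℕ) : ℕ∞)}.ncard := by
  have hf : ∀ k : ℕ, {A : Set α | A ⊆ N.E ∧ A.ncard = k}.Finite := fun k =>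
    N.ground_finite.finite_subsets.subset (fun _ hA => hA.1)
  have hS4sub : {Q : Set α | Q ⊆ N.E ∧ Q.ncard = 4 ∧ N.eRk Q = ((4 : ℕ) : ℕ∞)} ⊆
      {A : Set α | A ⊆ N.E ∧ A.ncard = 4} := fun A hA => ⟨hA.1, hA.2.1⟩
  have hS5sub : {Q : Set α | Q ⊆ N.E ∧ Q.ncard = 5 ∧ N.eRk Q = ((4 : ℕ) : ℕ∞)} ⊆
      {A : Set α | A ⊆ N.E ∧ A.ncard = 5} := fun A hA => ⟨hA.1, hA.2.1⟩
  have hsub : {A : Set α | A ⊆ N.E ∧ A.ncard = 2} ∪ {A : Set α | A ⊆ N.E ∧ A.ncard = 3} ∪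
      ({A : Set α | A ⊆ N.E ∧ A.ncard = 4} \ {Q : Set α | Q ⊆ N.E ∧ Q.ncard = 4 ∧ N.eRk Q = ((4 : ℕ) : ℕ∞)}) ∪
      ({A : Set α | A ⊆ N.E ∧ A.ncard = 5} \ {Q : Set α | Q ⊆ N.E ∧ Q.ncard = 5 ∧ N.eRk Q = ((4 : ℕ) : ℕ∞)}) ⊆
      rankSet N 2 ∪ rankSet N 3 := by
    rintro A (((⟨hAE, h2⟩ | ⟨hAE, h3⟩) | ⟨⟨hAE, h4⟩, hAS⟩) | ⟨⟨hAE, h5⟩, hAS⟩)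
    · left
      refine ⟨hAE, ?_⟩
      obtain ⟨x, y, hxy, rfl⟩ := ncard_eq_two.mp h2
      rw [hpairs x (hAE (by simp)) y (hAE (by simp)) hxy]; rfl
    · rcases (eRk_three_four_rank_four_seven hN hpairs hAE).1 h3 with h | h
      · exact Or.inl ⟨hAE, h⟩
      · exact Or.inr ⟨hAE, h⟩
    · rcases (eRk_three_four_rank_four_seven hN hpairs hAE).2 h4 with h | h | h
      · exact Or.inl ⟨hAE, h⟩
      · exact Or.inr ⟨hAE, h⟩
      · exact absurd ⟨hAE, h4, h⟩ hAS
    · rcases (eRk_five_six_rank_four_seven hN hE hcol hAE).1 h5 with h | h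
      · exact Or.inr ⟨hAE, h⟩
      · exact absurd ⟨hAE, h5, h⟩ hAS
  have h := ncard_le_ncard hsub ((rankSet_finite N 2).union (rankSet_finite N 3))
  rw [ncard_union_eq (rankSet_disjoint_of_ne N (by norm_num)) (rankSet_finite N 2) (rankSet_finite N 3),
    ncard_union_eq (by
        rw [Set.disjoint_left]
        rintro A ((⟨-, h2⟩ | ⟨-, h3⟩) | ⟨⟨-, h4⟩, -⟩) ⟨⟨-, h5⟩, -⟩ <;> omega)
      (((hf 2).union (hf 3)).union ((hf 4).subset sdiff_subset)) ((hf 5).subset sdiff_subset),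
    ncard_union_eq (by
        rw [Set.disjoint_left]
        rintro A (⟨-, h2⟩ | ⟨-, h3⟩) ⟨⟨-, h4⟩, -⟩ <;> omega) ((hf 2).union (hf 3)) ((hf 4).subset sdiff_subset),
    ncard_union_eq (by rw [Set.disjoint_left]; rintro A ⟨-, h2⟩ ⟨-, h3⟩; omega) (hf 2) (hf 3),
    ncard_sdiff hS4sub ((hf 4).subset hS4sub), ncard_sdiff hS5sub ((hf 5).subset hS5sub),
    ncard_setOf_subset_ncard_eq N.ground_finite 2, ncard_setOf_subset_ncard_eq N.ground_finite 3,
    ncard_setOf_subset_ncard_eq N.ground_finite 4, ncard_setOf_subset_ncard_eq N.ground_finite 5, hE] at h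
  have c2 : Nat.choose 7 2 = 21 := by decide
  have c3 : Nat.choose 7 3 = 35 := by decide
  have c4 : Nat.choose 7 4 = 35 := by decide
  have c5 : Nat.choose 7 5 = 21 := by decide
  have hS4 : {Q : Set α | Q ⊆ N.E ∧ Q.ncard = 4 ∧ N.eRk Q = ((4 : ℕ) : ℕ∞)}.ncard ≤ Nat.choose 7 4 := by
    have := ncard_le_ncard hS4sub (hf 4)
    rwa [ncard_setOf_subset_ncard_eq N.ground_finite 4, hE] at this
  have hS5 : {Q : Set α | Q ⊆ N.E ∧ Q.ncard = 5 ∧ N.eRk Q = ((4 : ℕ) : ℕ∞)}.ncard ≤ Nat.choose 7 5 := by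
    have := ncard_le_ncard hS5sub (hf 5)
    rwa [ncard_setOf_subset_ncard_eq N.ground_finite 5, hE] at this
  omega

/-- `f(3) + f(4) + t + q₂ ≥ 99`: the `3`-sets that are not rank-`2` triples, the `4`-sets that are not rank-`2`,
the `5`-sets, the `6`-sets and `E` all have rank `3` or `4`. -/
theorem ncard_rankSet_three_add_four_add_rankTwo_ge_rank_four_seven (hN : N.eRank = ((4 : ℕ) : ℕ∞))
    (hE : N.E.ncard = 7) (hcol : N.coloops = ∅) (hpairs : ∀ e ∈ N.E, ∀ f ∈ N.E, e ≠ f → N.eRk {e, f} = 2) :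
    99 ≤ (rankSet N 3).ncard + (rankSet N 4).ncard + (rankTwoTriples N).ncard +
      {Q : Set α | Q ⊆ N.E ∧ Q.ncard = 4 ∧ N.eRk Q = 2}.ncard := by
  have hf : ∀ k : ℕ, {A : Set α | A ⊆ N.E ∧ A.ncard = k}.Finite := fun k =>
    N.ground_finite.finite_subsets.subset (fun _ hA => hA.1)
  have hTsub : rankTwoTriples N ⊆ {A : Set α | A ⊆ N.E ∧ A.ncard = 3} := fun T hT => ⟨hT.1, hT.2.1⟩
  have hQsub : {Q : Set α | Q ⊆ N.E ∧ Q.ncard = 4 ∧ N.eRk Q = 2} ⊆ {A : Set α | A ⊆ N.E ∧ A.ncard = 4} :=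
    fun A hA => ⟨hA.1, hA.2.1⟩
  have hsub : ({A : Set α | A ⊆ N.E ∧ A.ncard = 3} \ rankTwoTriples N) ∪
      ({A : Set α | A ⊆ N.E ∧ A.ncard = 4} \ {Q : Set α | Q ⊆ N.E ∧ Q.ncard = 4 ∧ N.eRk Q = 2}) ∪
      {A : Set α | A ⊆ N.E ∧ A.ncard = 5} ∪ {A : Set α | A ⊆ N.E ∧ A.ncard = 6} ∪ {N.E} ⊆
      rankSet N 3 ∪ rankSet N 4 := by
    rintro A ((((⟨⟨hAE, h3⟩, hAT⟩ | ⟨⟨hAE, h4⟩, hAQ⟩) | ⟨hAE, h5⟩) | ⟨hAE, h6⟩) | hA)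
    · rcases (eRk_three_four_rank_four_seven hN hpairs hAE).1 h3 with h | h
      · exact absurd ⟨hAE, h3, h⟩ hAT
      · exact Or.inl ⟨hAE, h⟩
    · rcases (eRk_three_four_rank_four_seven hN hpairs hAE).2 h4 with h | h | h
      · exact absurd ⟨hAE, h4, h⟩ hAQ
      · exact Or.inl ⟨hAE, h⟩
      · exact Or.inr ⟨hAE, h⟩
    · rcases (eRk_five_six_rank_four_seven hN hE hcol hAE).1 h5 with h | h
      · exact Or.inl ⟨hAE, h⟩
      · exact Or.inr ⟨hAE, h⟩
    · exact Or.inr ⟨hAE, (eRk_five_six_rank_four_seven hN hE hcol hAE).2 h6⟩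
    · rw [mem_singleton_iff] at hA
      subst hA
      exact Or.inr ⟨subset_rfl, by rw [N.eRk_ground, hN]⟩
  have h := ncard_le_ncard hsub ((rankSet_finite N 3).union (rankSet_finite N 4))
  rw [ncard_union_eq (rankSet_disjoint_of_ne N (by norm_num)) (rankSet_finite N 3) (rankSet_finite N 4),
    ncard_union_eq (by
        rw [Set.disjoint_left]
        rintro A (((⟨⟨-, h3⟩, -⟩ | ⟨⟨-, h4⟩, -⟩) | ⟨-, h5⟩) | ⟨-, h6⟩) hA <;> rw [mem_singleton_iff] at hA <;>
          subst hA <;> omega)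
      (((((hf 3).subset sdiff_subset).union ((hf 4).subset sdiff_subset)).union (hf 5)).union (hf 6))
      (finite_singleton _),
    ncard_union_eq (by
        rw [Set.disjoint_left]
        rintro A ((⟨⟨-, h3⟩, -⟩ | ⟨⟨-, h4⟩, -⟩) | ⟨-, h5⟩) ⟨-, h6⟩ <;> omega)
      ((((hf 3).subset sdiff_subset).union ((hf 4).subset sdiff_subset)).union (hf 5)) (hf 6),
    ncard_union_eq (by
        rw [Set.disjoint_left]
        rintro A (⟨⟨-, h3⟩, -⟩ | ⟨⟨-, h4⟩, -⟩) ⟨-, h5⟩ <;> omega)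
      (((hf 3).subset sdiff_subset).union ((hf 4).subset sdiff_subset)) (hf 5),
    ncard_union_eq (by
        rw [Set.disjoint_left]
        rintro A ⟨⟨-, h3⟩, -⟩ ⟨⟨-, h4⟩, -⟩; omega) ((hf 3).subset sdiff_subset) ((hf 4).subset sdiff_subset),
    ncard_sdiff hTsub (rankTwoTriples_finite N), ncard_sdiff hQsub ((hf 4).subset hQsub), ncard_singleton,
    ncard_setOf_subset_ncard_eq N.ground_finite 3, ncard_setOf_subset_ncard_eq N.ground_finite 4,
    ncard_setOf_subset_ncard_eq N.ground_finite 5, ncard_setOf_subset_ncard_eq N.ground_finite 6, hE] at h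
  have c3 : Nat.choose 7 3 = 35 := by decide
  have c4 : Nat.choose 7 4 = 35 := by decide
  have c5 : Nat.choose 7 5 = 21 := by decide
  have c6 : Nat.choose 7 6 = 7 := by decide
  have hT : (rankTwoTriples N).ncard ≤ Nat.choose 7 3 := by
    have := ncard_le_ncard hTsub (hf 3)
    rwa [ncard_setOf_subset_ncard_eq N.ground_finite 3, hE] at this
  have hQ : {Q : Set α | Q ⊆ N.E ∧ Q.ncard = 4 ∧ N.eRk Q = 2}.ncard ≤ Nat.choose 7 4 := by
    have := ncard_le_ncard hQsub (hf 4)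
    rwa [ncard_setOf_subset_ncard_eq N.ground_finite 4, hE] at this
  omega

/-- `f(4) ≥ 8 + s₅ + s₄`: the ground set, the seven `6`-sets, the spanning `5`-sets and the spanning `4`-sets. -/
theorem ncard_rankSet_four_ge_rank_four_seven (hN : N.eRank = ((4 : ℕ) : ℕ∞)) (hE : N.E.ncard = 7)
    (hcol : N.coloops = ∅) :
    8 + {Q : Set α | Q ⊆ N.E ∧ Q.ncard = 5 ∧ N.eRk Q = ((4 : ℕ) : ℕ∞)}.ncard +
      {Q : Set α | Q ⊆ N.E ∧ Q.ncard = 4 ∧ N.eRk Q = ((4 : ℕ) : ℕ∞)}.ncard ≤ (rankSet N 4).ncard := by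
  have hf : ∀ k : ℕ, {A : Set α | A ⊆ N.E ∧ A.ncard = k}.Finite := fun k =>
    N.ground_finite.finite_subsets.subset (fun _ hA => hA.1)
  have hS4 : {Q : Set α | Q ⊆ N.E ∧ Q.ncard = 4 ∧ N.eRk Q = ((4 : ℕ) : ℕ∞)}.Finite :=
    (hf 4).subset (fun A hA => ⟨hA.1, hA.2.1⟩)
  have hS5 : {Q : Set α | Q ⊆ N.E ∧ Q.ncard = 5 ∧ N.eRk Q = ((4 : ℕ) : ℕ∞)}.Finite :=
    (hf 5).subset (fun A hA => ⟨hA.1, hA.2.1⟩)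
  have hsub : {N.E} ∪ {A : Set α | A ⊆ N.E ∧ A.ncard = 6} ∪
      {Q : Set α | Q ⊆ N.E ∧ Q.ncard = 5 ∧ N.eRk Q = ((4 : ℕ) : ℕ∞)} ∪
      {Q : Set α | Q ⊆ N.E ∧ Q.ncard = 4 ∧ N.eRk Q = ((4 : ℕ) : ℕ∞)} ⊆ rankSet N 4 := by
    rintro A (((hA | ⟨hAE, h6⟩) | ⟨hAE, -, h4⟩) | ⟨hAE, -, h4⟩)
    · rw [mem_singleton_iff] at hA
      subst hA
      exact ⟨subset_rfl, by rw [N.eRk_ground, hN]⟩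
    · exact ⟨hAE, (eRk_five_six_rank_four_seven hN hE hcol hAE).2 h6⟩
    · exact ⟨hAE, h4⟩
    · exact ⟨hAE, h4⟩
  have h := ncard_le_ncard hsub (rankSet_finite N 4)
  rw [ncard_union_eq (by
        rw [Set.disjoint_left]
        rintro A ((hA | ⟨-, h6⟩) | ⟨-, h5, -⟩) ⟨-, h4, -⟩
        · rw [mem_singleton_iff] at hA; subst hA; omega
        · omega
        · omega) (((finite_singleton _).union (hf 6)).union hS5) hS4,
    ncard_union_eq (by
        rw [Set.disjoint_left]
        rintro A (hA | ⟨-, h6⟩) ⟨-, h5, -⟩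
        · rw [mem_singleton_iff] at hA; subst hA; omega
        · omega) ((finite_singleton _).union (hf 6)) hS5,
    ncard_union_eq (by
        rw [Set.disjoint_left]
        rintro A hA ⟨-, h6⟩
        rw [mem_singleton_iff] at hA; subst hA; omega) (finite_singleton _) (hf 6),
    ncard_singleton, ncard_setOf_subset_ncard_eq N.ground_finite 6, hE, show Nat.choose 7 6 = 7 by decide] at h
  omega

/-- `N_N(4, 3) ≤ 35 − t`: a spanning set whose complement has rank `3` is a `4`-set whose complement is a
`3`-set of rank `3`. -/
theorem ncard_profileSet_four_three_le_rank_four_seven (hE : N.E.ncard = 7) :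
    (profileSet N 4 3).ncard + (rankTwoTriples N).ncard ≤ 35 := by
  have hf3 : {A : Set α | A ⊆ N.E ∧ A.ncard = 3}.Finite := N.ground_finite.finite_subsets.subset (fun _ hA => hA.1)
  have hTsub : rankTwoTriples N ⊆ {A : Set α | A ⊆ N.E ∧ A.ncard = 3} := fun T hT => ⟨hT.1, hT.2.1⟩
  have hsub : (fun A => N.E \ A) '' profileSet N 4 3 ⊆ {A : Set α | A ⊆ N.E ∧ A.ncard = 3} \ rankTwoTriples N := by
    rintro B ⟨A, ⟨hAE, hA4, hAc⟩, rfl⟩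
    have hAfin : A.Finite := N.ground_finite.subset hAE
    have h1 : ((4 : ℕ) : ℕ∞) ≤ (A.ncard : ℕ∞) := by
      rw [← hA4, hAfin.cast_ncard_eq]; exact N.eRk_le_encard A
    have h2 : ((3 : ℕ) : ℕ∞) ≤ ((N.E \ A).ncard : ℕ∞) := by
      rw [← hAc, (N.ground_finite.subset sdiff_subset).cast_ncard_eq]; exact N.eRk_le_encard _
    have h3 : A.ncard + (N.E \ A).ncard = N.E.ncard := by
      rw [← ncard_union_eq disjoint_sdiff_right hAfin (N.ground_finite.subset sdiff_subset), union_sdiff_cancel hAE]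
    have h1' : 4 ≤ A.ncard := by exact_mod_cast h1
    have h2' : 3 ≤ (N.E \ A).ncard := by exact_mod_cast h2
    refine ⟨⟨sdiff_subset, by show (N.E \ A).ncard = 3; omega⟩, fun hT => ?_⟩
    have := hT.2.2
    rw [hAc] at this
    exact absurd this (by decide)
  have hinj : InjOn (fun A => N.E \ A) (profileSet N 4 3) := by
    intro A hA A' hA' hAA
    have e : N.E \ A = N.E \ A' := hAA
    have := congrArg (fun S => N.E \ S) e
    simp only [sdiff_sdiff_cancel_left hA.1, sdiff_sdiff_cancel_left hA'.1] at this
    exact this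
  have h := ncard_le_ncard hsub (hf3.subset sdiff_subset)
  rw [hinj.ncard_image, ncard_sdiff hTsub (rankTwoTriples_finite N), ncard_setOf_subset_ncard_eq N.ground_finite 3,
    hE, show Nat.choose 7 3 = 35 by decide] at h
  have hT : (rankTwoTriples N).ncard ≤ 35 := by
    have := ncard_le_ncard hTsub hf3
    rwa [ncard_setOf_subset_ncard_eq N.ground_finite 3, hE, show Nat.choose 7 3 = 35 by decide] at this
  omega

/-- `N_N(4, 2) ≤ s₅ + t`: a spanning set whose complement has rank `2` is a spanning `5`-set or a `4`-set whose
complement is a rank-`2` triple. -/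
theorem ncard_profileSet_four_two_le_rank_four_seven (hE : N.E.ncard = 7) :
    (profileSet N 4 2).ncard ≤ {Q : Set α | Q ⊆ N.E ∧ Q.ncard = 5 ∧ N.eRk Q = ((4 : ℕ) : ℕ∞)}.ncard +
      (rankTwoTriples N).ncard := by
  have hf5 : {A : Set α | A ⊆ N.E ∧ A.ncard = 5}.Finite := N.ground_finite.finite_subsets.subset (fun _ hA => hA.1)
  have hS5 : {Q : Set α | Q ⊆ N.E ∧ Q.ncard = 5 ∧ N.eRk Q = ((4 : ℕ) : ℕ∞)}.Finite :=
    hf5.subset (fun A hA => ⟨hA.1, hA.2.1⟩)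
  have hsub : profileSet N 4 2 ⊆ {Q : Set α | Q ⊆ N.E ∧ Q.ncard = 5 ∧ N.eRk Q = ((4 : ℕ) : ℕ∞)} ∪
      (fun T => N.E \ T) '' rankTwoTriples N := by
    rintro A ⟨hAE, hA4, hAc⟩
    have hAfin : A.Finite := N.ground_finite.subset hAE
    have h1 : ((4 : ℕ) : ℕ∞) ≤ (A.ncard : ℕ∞) := by
      rw [← hA4, hAfin.cast_ncard_eq]; exact N.eRk_le_encard A
    have h2 : ((2 : ℕ) : ℕ∞) ≤ ((N.E \ A).ncard : ℕ∞) := by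
      rw [← hAc, (N.ground_finite.subset sdiff_subset).cast_ncard_eq]; exact N.eRk_le_encard _
    have h3 : A.ncard + (N.E \ A).ncard = N.E.ncard := by
      rw [← ncard_union_eq disjoint_sdiff_right hAfin (N.ground_finite.subset sdiff_subset), union_sdiff_cancel hAE]
    have h1' : 4 ≤ A.ncard := by exact_mod_cast h1
    have h2' : 2 ≤ (N.E \ A).ncard := by exact_mod_cast h2
    rcases Nat.lt_or_ge A.ncard 5 with h | h
    · right
      refine ⟨N.E \ A, ⟨sdiff_subset, by omega, hAc⟩, sdiff_sdiff_cancel_left hAE⟩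
    · left
      exact ⟨hAE, by omega, hA4⟩
  have h := ncard_le_ncard hsub (hS5.union ((rankTwoTriples_finite N).image _))
  exact h.trans ((ncard_union_le _ _).trans (Nat.add_le_add_left (ncard_image_le (rankTwoTriples_finite N)) _))

/-- `t + q₂ ≤ 21`: the rank-`2` triples and the rank-`2` four-sets are rank-`2` sets with at least three points,
and those number at most `C(7, 2)` (the closure of a pair has at most `4` points). -/
theorem ncard_rankTwoTriples_add_rankTwo_four_le_rank_four_seven (hN : N.eRank = ((4 : ℕ) : ℕ∞))
    (hE : N.E.ncard = 7) (hcol : N.coloops = ∅) (hpairs : ∀ e ∈ N.E, ∀ f ∈ N.E, e ≠ f → N.eRk {e, f} = 2) :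
    (rankTwoTriples N).ncard + {Q : Set α | Q ⊆ N.E ∧ Q.ncard = 4 ∧ N.eRk Q = 2}.ncard ≤ 21 := by
  have hcl : ∀ x ∈ N.E, ∀ y ∈ N.E, x ≠ y → (N.closure {x, y}).ncard ≤ 4 := by
    intro x hx y hy hxy
    have := ncard_closure_pair_le_of_coloops' N hN (by norm_num) hcol hpairs hx hy hxy
    rw [hE] at this
    omega
  have hbig := ncard_bigRankTwo_le_choose N hpairs hcl
  rw [hE, show Nat.choose 7 2 = 21 by decide] at hbig
  have hsub : rankTwoTriples N ∪ {Q : Set α | Q ⊆ N.E ∧ Q.ncard = 4 ∧ N.eRk Q = 2} ⊆ bigRankTwo N := by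
    rintro A (⟨hAE, h3, h2⟩ | ⟨hAE, h4, h2⟩)
    · exact ⟨hAE, by omega, h2⟩
    · exact ⟨hAE, by omega, h2⟩
  have hQfin : {Q : Set α | Q ⊆ N.E ∧ Q.ncard = 4 ∧ N.eRk Q = 2}.Finite :=
    N.ground_finite.finite_subsets.subset (fun _ hA => hA.1)
  have h := ncard_le_ncard hsub (bigRankTwo_finite N)
  rw [ncard_union_eq (by rw [Set.disjoint_left]; rintro A ⟨-, h3, -⟩ ⟨-, h4, -⟩; omega)
    (rankTwoTriples_finite N) hQfin] at h
  omega

end RankFourOnSeven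

end S1

end PercRepro
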